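import Summits.QuantumFields.YangMills.Theorems.BalabanUVNodesN14TargetOfBinderAndClassLawTV
import Summits.QuantumFields.YangMills.Theorems.BalabanUVNodesN20ClassLawTVCoarsening

/-!
# DAG node N14 (NE1′) — N14's BINDER UNDER KEY COARSENING (the v6 `kr := wkey` re-keying, N14 side): the MGF form pushes forward along any fibre map (law of total
# tilted expectation per fibre), the coarse class-wise tilted mean is the CONDITIONAL average of the fine ones, and `TiltedMeanMatching` DESCENDS to the coarser key
# at the price of ONE-RUN FIBRE OSCILLATION of run A's class-wise tilted means (a decoupling letter) — NO two-run conditional-law input; with dag-n20-w4's free descent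
# of the class-law TV letter, FILE 1's road runs at every coarser key

Cell `pub-ymgap` (HUMAN RULING D-0062, Track A), WIDTH SEAT `pub-ymgap-dag-n14-w2` (NODE n14 = NE1′), generation 6, FILE 7; `--kind proof --supports
stmt-QuantumFields-20544 --as helper` (K3⁷; helper, NOT a discharge; count-neutral).  THEOREMS ONLY (0 `def`, 0 `instance`, 0 `sorry`).  Imports this seat's FILE 1
`…N14TargetOfBinderAndClassLawTV` (p612221: `mgf_finsetSum_measure`, `tiltedMean_finsetSum_measure`, `isFiniteMeasure_finsetSum`, `exists_hybridNE7_of_binder_classLawTV`;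
NE1′'s `MGFForm`, `TiltedMeanMatching`, `abs_tiltedMean_le`) and dag-n20-w4 g2's `…N20ClassLawTVCoarsening` (p61xxxx: `sum_push_image_eq_sum`, `classLawTV_push_of_classLawTV` —
the class-law TV letter CONTRACTS under coarsening) — CITED BY NAME; the pushed weights are spelled as there (`k ↦ Σ_{τ ∈ T K, f K τ = k} A K t τ` on `(T K).image (f K)`).

WHY.  Plan g83∕g84 book K3⁷ v6 with the core law re-keyed at the WINDOW key (`kr := wkey`, idea-3 `window-key-core`); dag-n20-w4 showed the class-law TV letter descends to
any coarser key for free and dag-n19-w1 priced `Core`'s descent∕ascent.  Node N14's binder `TiltedMeanMatching` is produced at the FINE (history) key by NE1′'s ledgers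
(`Spine/NE1p/TiltedMeanCrossover`, `…TiltedMeanVisibilityTwoRun`); this file prices its DESCENT.  For a fibre map `f K : ι → κ` the pushed class pieces `Σ_{f τ = k} ν K τ`
are again an MGF form (§1) and the coarse class-wise tilted mean is the conditional average `m^k_s = Σ_{τ ∈ fibre} p_s(τ | k)·m_s(τ)` (§2, FILE 1's law of total tilted
expectation on the fibre).  Hence (§3)
  `m′^k_s − m^k_s = Σ_{fibre} q_s(τ|k)·(m′_s − m_s)(τ) + Σ_{fibre} (q_s(τ|k) − p_s(τ|k))·m_s(τ)`,
first term `≤ η_K` (the fine binder, averaged under run B's conditional law), second `≤ ω_K` := the OSCILLATION of run A's fine class-wise tilted means over the fibre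
(`Σ(q − p)(m − m̄)`, total conditional mass 1 each) — ★★ `tiltedMeanMatching_push_of_fibreOsc`: `TiltedMeanMatching` at the coarse key with `η + ω`, from the fine binder and a
ONE-RUN decoupling letter (in the history → window application: the loop observable's history-conditioned tilted mean does not see old large-field structure far from
the loop), and NOT from any two-run statement about the conditional laws `p(·|k)`, `q(·|k)` — which at history → window are exactly the TV-far old-structure laws
(dag-n20-w5 (LS) ∕ the window-key-core caricature).  The alternative price via the conditional class-law TV (`≤ η + 2B·ρᶜ`, §3 `…_of_condClassLawTV`) is recorded for
completeness and is the USELESS one in that application.  §4 feeds FILE 1 at the coarse key: ★★★ `exists_hybridNE7_push_of_binder_fibreOsc_classLawTV` — the coarse-key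
per-set class-law TV letter (the v6 window letter, taken AT THE COARSE KEY), the fine N14 binder, the fibre oscillation, a coarse bad weight ⇒ the `∃`-hybrid at the coarse key.

HONEST FRAMING.  [folklore] finite-sum ∕ tilted-measure bookkeeping on hypothesis SHAPES; the fine binder `η`, the fibre oscillation `ω`, the coarse class-law TV `ρ` and bad weight
`W` are HYPOTHESES produced by nobody (no live Stage-13 tuple exhibited, K0⁷ OPEN; `wkey` not yet defined at Stage 13 — window-key-core K3); proves NO estimate of the
programme; nothing of Bałaban's asserted or instantiated; NE1′ ∕ NE7 ∕ NE7b NOT PRINTED as two-run statements for d = 4, NOT proved; N14 ∕ N19 ∕ N20 NOT discharged; K3⁷ OPEN,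
skeleton v5 untouched; counts UNMOVED.  One finite 𝕋⁴ programme at fixed ε; R4 closes only the CONDITIONAL finite-𝕋⁴ rung `BalabanLadder.UV` — NOT ℝ⁴, NOT OS, NOT the Yang–Mills
mass gap (Clay), which is NOT proved by any of this.
-/

noncomputable section

open MeasureTheory ProbabilityTheory Finset

namespace YMDAG.N14.BinderKeyCoarsening

open Literature.MathematicalPhysics.QuantumFieldTheory.Balaban1983to89
open Literature.MathematicalPhysics.QuantumFieldTheory.Balaban1983to89.T4MatchingAssembly (HybridNE7)
open Summit.QuantumFields.BalabanUV.T4Continuum.NE1p.DressedMGFForm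
open Summit.QuantumFields.BalabanUV.T4Continuum.NE1p.TiltedMeanInfluence (abs_tiltedMean_le)
open Summit.QuantumFields.YangMills.BalabanUVNodes.N20ClassLawTVCoarsening (sum_push_image_eq_sum)
open YMDAG.N14.TargetOfBinderAndClassLawTV (mgf_finsetSum_measure tiltedMean_finsetSum_measure isFiniteMeasure_finsetSum exists_hybridNE7_of_binder_classLawTV)

/-! ## §1 The MGF form pushes forward along a key coarsening -/

section Push

variable {ι κ : Type*} [DecidableEq κ] {Ω Ω' : ℕ → Type*} [∀ K, MeasurableSpace (Ω K)] [∀ K, MeasurableSpace (Ω' K)]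
  {l₀ B : ℝ} {T : ℕ → Finset ι} {Bad : ℕ → ℝ → Finset ι} {f : ℕ → ι → κ}
  {F : ∀ K, Ω K → ℝ} {ν : ∀ K, ι → Measure (Ω K)} {F' : ∀ K, Ω' K → ℝ} {ν' : ∀ K, ι → Measure (Ω' K)}
  {A Bf : ℕ → ℝ → ι → ℝ} {η ω ρc : ℕ → ℝ}

/-- ★ **THE MGF FORM PUSHES FORWARD ALONG ANY FIBRE MAP** (law of total expectation per fibre, FILE 1's `mgf_finsetSum_measure`): the fibre-summed dressed class totals
`k ↦ Σ_{τ ∈ T K, f K τ = k} A K t τ` on the coarse carriers `(T K).image (f K)` are the MGFs of the same observable under the fibre-summed class pieces. [folklore] -/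
theorem mgfForm_push (hA : MGFForm B T F ν A) (f : ℕ → ι → κ) :
    MGFForm B (fun K => (T K).image (f K)) F (fun K k => ∑ τ ∈ (T K).filter (fun τ => f K τ = k), ν K τ)
      (fun K t k => ∑ τ ∈ (T K).filter (fun τ => f K τ = k), A K t τ) where
  nonneg := hA.nonneg
  meas := hA.meas
  bound := hA.bound
  finite K k _ := isFiniteMeasure_finsetSum _ (ν K) fun τ hτ => hA.finite K τ (Finset.mem_filter.mp hτ).1
  repr K t k _ := by
    rw [mgf_finsetSum_measure _ (ν K) (fun τ hτ => hA.finite K τ (Finset.mem_filter.mp hτ).1) (hA.meas K) (hA.bound K) t]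
    exact Finset.sum_congr rfl fun τ hτ => hA.repr K t τ (Finset.mem_filter.mp hτ).1

/-! ## §2 The coarse class-wise tilted mean is the conditional average of the fine ones -/

/-- **COARSE TILTED MEAN = CONDITIONAL AVERAGE OVER THE FIBRE**: for a coarse class `k` with positive fibre total,
`tiltedMean (F K) (Σ_{fibre} ν K τ) s = Σ_{τ ∈ fibre} (A K s τ ∕ Σ_{fibre} A K s)·tiltedMean (F K) (ν K τ) s` (FILE 1's `tiltedMean_finsetSum_measure` on the fibre). [folklore] -/
theorem tiltedMean_push_eq_condAvg (hA : MGFForm B T F ν A) (K : ℕ) (k : κ) {s : ℝ}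
    (hZ : 0 < ∑ τ ∈ (T K).filter (fun τ => f K τ = k), A K s τ) :
    tiltedMean (F K) (∑ τ ∈ (T K).filter (fun τ => f K τ = k), ν K τ) s
      = ∑ τ ∈ (T K).filter (fun τ => f K τ = k),
          A K s τ / (∑ σ ∈ (T K).filter (fun τ => f K τ = k), A K s σ) * tiltedMean (F K) (ν K τ) s := by
  set fib := (T K).filter (fun τ => f K τ = k)
  have hfin : ∀ τ ∈ fib, IsFiniteMeasure (ν K τ) := fun τ hτ => hA.finite K τ (Finset.mem_filter.mp hτ).1
  have hr : ∀ τ ∈ fib, mgf (F K) (ν K τ) s = A K s τ := fun τ hτ => (hA.repr K s τ (Finset.mem_filter.mp hτ).1).symm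
  have hsum : ∑ σ ∈ fib, mgf (F K) (ν K σ) s = ∑ σ ∈ fib, A K s σ := Finset.sum_congr rfl hr
  rw [tiltedMean_finsetSum_measure fib (ν K) hfin (hA.meas K) (hA.bound K) s (hsum ▸ hZ), hsum]
  exact Finset.sum_congr rfl fun τ hτ => by rw [hr τ hτ]

/-! ## §3 Descent of N14's binder: fine binder + fibre oscillation (one-run) — or + conditional class-law TV -/

/-- Pure finite sums: two conditional laws `p, q` on one fibre (nonnegative, total `1` each), fine tilted means `m, m′` with `|m′ − m| ≤ η` pointwise and `m` oscillating by at
most `ω` over the fibre ⇒ `|Σ q·m′ − Σ p·m| ≤ η + ω`. [folklore] -/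
theorem abs_condAvg_sub_condAvg_le_of_osc {S : Finset ι} {p q m m' : ι → ℝ} {η' ω' : ℝ} (hp : ∀ τ ∈ S, 0 ≤ p τ) (hq : ∀ τ ∈ S, 0 ≤ q τ)
    (hp1 : ∑ τ ∈ S, p τ = 1) (hq1 : ∑ τ ∈ S, q τ = 1) (hη : ∀ τ ∈ S, |m' τ - m τ| ≤ η') (hω : ∀ τ ∈ S, ∀ τ' ∈ S, |m τ - m τ'| ≤ ω') :
    |∑ τ ∈ S, q τ * m' τ - ∑ τ ∈ S, p τ * m τ| ≤ η' + ω' := by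
  -- `Σ q m′ − Σ p m = Σ q (m′ − m) + (Σ q m − Σ p m)` and `Σ q m − Σ p m = Σ_τ Σ_τ' q τ p τ' (m τ − m τ')`
  have h1 : |∑ τ ∈ S, q τ * m' τ - ∑ τ ∈ S, q τ * m τ| ≤ η' := by
    rw [← Finset.sum_sub_distrib]
    calc |∑ τ ∈ S, (q τ * m' τ - q τ * m τ)| ≤ ∑ τ ∈ S, |q τ * m' τ - q τ * m τ| := Finset.abs_sum_le_sum_abs _ _
      _ ≤ ∑ τ ∈ S, q τ * η' := Finset.sum_le_sum fun τ hτ => by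
          rw [← mul_sub, abs_mul, abs_of_nonneg (hq τ hτ)]; exact mul_le_mul_of_nonneg_left (hη τ hτ) (hq τ hτ)
      _ = η' := by rw [← Finset.sum_mul, hq1, one_mul]
  have h2 : |∑ τ ∈ S, q τ * m τ - ∑ τ ∈ S, p τ * m τ| ≤ ω' := by
    have hqm : ∑ τ ∈ S, q τ * m τ = ∑ τ ∈ S, ∑ τ' ∈ S, q τ * p τ' * m τ := Finset.sum_congr rfl fun τ _ => by
      rw [← Finset.sum_mul, ← Finset.mul_sum, hp1, mul_one]
    have hpm : ∑ τ' ∈ S, p τ' * m τ' = ∑ τ ∈ S, ∑ τ' ∈ S, q τ * p τ' * m τ' := by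
      rw [Finset.sum_comm]
      exact Finset.sum_congr rfl fun τ' _ => by rw [← Finset.sum_mul, ← Finset.sum_mul, hq1, one_mul]
    rw [hqm, hpm, ← Finset.sum_sub_distrib]
    calc |∑ τ ∈ S, (∑ τ' ∈ S, q τ * p τ' * m τ - ∑ τ' ∈ S, q τ * p τ' * m τ')|
        ≤ ∑ τ ∈ S, |∑ τ' ∈ S, q τ * p τ' * m τ - ∑ τ' ∈ S, q τ * p τ' * m τ'| := Finset.abs_sum_le_sum_abs _ _
      _ ≤ ∑ τ ∈ S, ∑ τ' ∈ S, q τ * p τ' * ω' := Finset.sum_le_sum fun τ hτ => by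
          rw [← Finset.sum_sub_distrib]
          refine (Finset.abs_sum_le_sum_abs _ _).trans (Finset.sum_le_sum fun τ' hτ' => ?_)
          rw [← mul_sub, abs_mul, abs_of_nonneg (mul_nonneg (hq τ hτ) (hp τ' hτ'))]
          exact mul_le_mul_of_nonneg_left (hω τ hτ τ' hτ') (mul_nonneg (hq τ hτ) (hp τ' hτ'))
      _ = ω' := by
          have hin : ∀ τ ∈ S, ∑ τ' ∈ S, q τ * p τ' * ω' = q τ * ω' := fun τ _ => by
            rw [show (fun τ' => q τ * p τ' * ω') = fun τ' => (q τ * ω') * p τ' from funext fun _ => by ring,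
              ← Finset.mul_sum, hp1, mul_one]
          rw [Finset.sum_congr rfl hin, ← Finset.sum_mul, hq1, one_mul]
  calc |∑ τ ∈ S, q τ * m' τ - ∑ τ ∈ S, p τ * m τ|
      = |(∑ τ ∈ S, q τ * m' τ - ∑ τ ∈ S, q τ * m τ) + (∑ τ ∈ S, q τ * m τ - ∑ τ ∈ S, p τ * m τ)| := by ring_nf
    _ ≤ η' + ω' := (abs_add_le _ _).trans (add_le_add h1 h2)

/-- ★★ **N14's BINDER DESCENDS TO A COARSER KEY AT THE PRICE OF ONE-RUN FIBRE OSCILLATION.**  Fine data in MGF form with N14's binder `TiltedMeanMatching l₀ T Bad F ν F′ ν′ η`;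
a coarse bad-class policy `Bad′` under which every fine class of a GOOD coarse class is good; positive fibre totals of both runs on good coarse classes at every tilt of the
window; and the ONE-RUN decoupling letter: run A's fine class-wise tilted means oscillate by at most `ω_K` over each good fibre.  THEN the pushed runs satisfy
`TiltedMeanMatching l₀ (K ↦ (T K).image (f K)) Bad′ … (η + ω)`.  No two-run statement about the conditional laws `p(·|k)`, `q(·|k)` is used. [folklore] -/
theorem tiltedMeanMatching_push_of_fibreOsc [DecidableEq ι] (hA : MGFForm B T F ν A) (hB : MGFForm B T F' ν' Bf)
    (hη : TiltedMeanMatching l₀ T Bad F ν F' ν' η) {Bad' : ℕ → ℝ → Finset κ}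
    (hgood : ∀ (K : ℕ) (t : ℝ), |t| ≤ l₀ → ∀ τ ∈ T K, f K τ ∉ Bad' K t → τ ∉ Bad K t)
    (hpos : ∀ (K : ℕ) (t : ℝ), |t| ≤ l₀ → ∀ k ∈ (T K).image (f K) \ Bad' K t, ∀ s : ℝ, |s| ≤ l₀ →
      0 < ∑ τ ∈ (T K).filter (fun τ => f K τ = k), A K s τ ∧ 0 < ∑ τ ∈ (T K).filter (fun τ => f K τ = k), Bf K s τ)
    (hω : ∀ (K : ℕ) (t : ℝ), |t| ≤ l₀ → ∀ k ∈ (T K).image (f K) \ Bad' K t,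
      ∀ τ ∈ (T K).filter (fun τ => f K τ = k), ∀ τ' ∈ (T K).filter (fun τ => f K τ = k), ∀ s : ℝ, |s| ≤ l₀ →
        |tiltedMean (F K) (ν K τ) s - tiltedMean (F K) (ν K τ') s| ≤ ω K) :
    TiltedMeanMatching l₀ (fun K => (T K).image (f K)) Bad' F (fun K k => ∑ τ ∈ (T K).filter (fun τ => f K τ = k), ν K τ) F'
      (fun K k => ∑ τ ∈ (T K).filter (fun τ => f K τ = k), ν' K τ) (fun K => η K + ω K) := by
  intro K t ht k hk s hs
  obtain ⟨hZA, hZB⟩ := hpos K t ht k hk s hs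
  have hkBad : k ∉ Bad' K t := (Finset.mem_sdiff.mp hk).2
  set fib := (T K).filter (fun τ => f K τ = k) with hfib
  rw [tiltedMean_push_eq_condAvg hB K k hZB, tiltedMean_push_eq_condAvg hA K k hZA]
  refine abs_condAvg_sub_condAvg_le_of_osc (fun τ hτ => div_nonneg (hA.nonneg' K s (Finset.mem_filter.mp hτ).1) hZA.le)
    (fun τ hτ => div_nonneg (hB.nonneg' K s (Finset.mem_filter.mp hτ).1) hZB.le)
    (by rw [← Finset.sum_div, div_self hZA.ne']) (by rw [← Finset.sum_div, div_self hZB.ne']) (fun τ hτ => ?_) (fun τ hτ τ' hτ' => hω K t ht k hk τ hτ τ' hτ' s hs)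
  obtain ⟨hτT, hτk⟩ := Finset.mem_filter.mp hτ
  exact hη K t ht τ (Finset.mem_sdiff.mpr ⟨hτT, hgood K t ht τ hτT (hτk ▸ hkBad)⟩) s hs

/-- The ALTERNATIVE price (recorded for completeness; the useless one at history → window, where the conditional laws are the TV-far old-structure laws): fine binder `η`
+ per-set CONDITIONAL class-law TV `ρᶜ_K` within each good coarse class ⇒ coarse binder `η + 2B·ρᶜ` (FILE 1's `abs_avg_sub_avg_le` on the fibre with no bad class). [folklore] -/
theorem tiltedMeanMatching_push_of_condClassLawTV [DecidableEq ι] (hA : MGFForm B T F ν A) (hB : MGFForm B T F' ν' Bf)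
    (hη : TiltedMeanMatching l₀ T Bad F ν F' ν' η) (hη0 : ∀ K, 0 ≤ η K) {Bad' : ℕ → ℝ → Finset κ}
    (hgood : ∀ (K : ℕ) (t : ℝ), |t| ≤ l₀ → ∀ τ ∈ T K, f K τ ∉ Bad' K t → τ ∉ Bad K t)
    (hpos : ∀ (K : ℕ) (t : ℝ), |t| ≤ l₀ → ∀ k ∈ (T K).image (f K) \ Bad' K t, ∀ s : ℝ, |s| ≤ l₀ →
      0 < ∑ τ ∈ (T K).filter (fun τ => f K τ = k), A K s τ ∧ 0 < ∑ τ ∈ (T K).filter (fun τ => f K τ = k), Bf K s τ)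
    (hρc : ∀ (K : ℕ) (t : ℝ), |t| ≤ l₀ → ∀ k ∈ (T K).image (f K) \ Bad' K t, ∀ s : ℝ, |s| ≤ l₀ → ∀ S ⊆ (T K).filter (fun τ => f K τ = k),
      |(∑ τ ∈ S, A K s τ) / (∑ τ ∈ (T K).filter (fun τ => f K τ = k), A K s τ)
        - (∑ τ ∈ S, Bf K s τ) / (∑ τ ∈ (T K).filter (fun τ => f K τ = k), Bf K s τ)| ≤ ρc K) :
    TiltedMeanMatching l₀ (fun K => (T K).image (f K)) Bad' F (fun K k => ∑ τ ∈ (T K).filter (fun τ => f K τ = k), ν K τ) F'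
      (fun K k => ∑ τ ∈ (T K).filter (fun τ => f K τ = k), ν' K τ) (fun K => η K + 2 * B * ρc K) := by
  intro K t ht k hk s hs
  obtain ⟨hZA, hZB⟩ := hpos K t ht k hk s hs
  have hkBad : k ∉ Bad' K t := (Finset.mem_sdiff.mp hk).2
  rw [tiltedMean_push_eq_condAvg hB K k hZB, tiltedMean_push_eq_condAvg hA K k hZA]
  have h := YMDAG.N14.TargetOfBinderAndClassLawTV.abs_avg_sub_avg_le (Bad := ∅) (W := 0) (Finset.empty_subset _)
    (fun τ hτ => hA.nonneg' K s (Finset.mem_filter.mp hτ).1) hZA (by simp) hA.nonneg (hη0 K)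
    (fun τ _ => abs_tiltedMean_le (hA.bound K) hA.nonneg s) (fun τ _ => abs_tiltedMean_le (hB.bound K) hB.nonneg s)
    (fun τ hτ => by
      obtain ⟨hτT, hτk⟩ := Finset.mem_filter.mp (Finset.mem_sdiff.mp hτ).1
      exact hη K t ht τ (Finset.mem_sdiff.mpr ⟨hτT, hgood K t ht τ hτT (hτk ▸ hkBad)⟩) s hs)
    (hρc K t ht k hk s hs)
  simpa using h

/-! ## §4 FILE 1's road at the coarser key: the `∃`-hybrid from the coarse class-law TV letter, the fine binder and the fibre oscillation -/

/-- ★★★ **THE `∃`-HYBRID AT A COARSER KEY FROM THE COARSE CLASS-LAW TV LETTER, N14's FINE BINDER AND THE FIBRE OSCILLATION** (FILE 1's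
`exists_hybridNE7_of_binder_classLawTV` BY NAME at the pushed MGF forms): fine MGF forms, positive fine totals, the dictionary (totals are preserved under push-forward,
dag-n20-w4's `sum_push_image_eq_sum`); N14's fine binder `η` descended by §3 (`+ ω`); a coarse bad weight `W` under the pushed run-A class law; dag-n20-w4's per-set class-law TV
letter AT THE COARSE KEY (the window letter — or the fine letter pushed for free by `classLawTV_push_of_classLawTV`) with `0 ≤ ρ_K < 1`; `Σ η, Σ ω, Σ W, Σ ρ < ∞` ⇒
`∃ shA shB, HybridNE7 l₀ vol (K ↦ (T K).image (f K)) A′ B′ ∅ 0 shA shB ρ δ` for the pushed weights, `δ_K = l₀(η_K + ω_K + 2B·W_K + 2B·ρ_K)∕vol`. [folklore] -/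
theorem exists_hybridNE7_push_of_binder_fibreOsc_classLawTV [DecidableEq ι] {vol : ℝ} {W ρ : ℕ → ℝ} {Z : ℕ → ℝ → ℝ} (hl₀ : 0 ≤ l₀) (hvol : 0 < vol)
    (hA : MGFForm B T F ν A) (hB : MGFForm B T F' ν' Bf) (hη : TiltedMeanMatching l₀ T Bad F ν F' ν' η) (hη0 : ∀ K, 0 ≤ η K) (hηs : Summable η)
    {Bad' : ℕ → ℝ → Finset κ} (hBadT' : ∀ (K : ℕ) (t : ℝ), |t| ≤ l₀ → Bad' K t ⊆ (T K).image (f K))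
    (hgood : ∀ (K : ℕ) (t : ℝ), |t| ≤ l₀ → ∀ τ ∈ T K, f K τ ∉ Bad' K t → τ ∉ Bad K t)
    (hpos : ∀ (K : ℕ) (t : ℝ), |t| ≤ l₀ → ∀ k ∈ (T K).image (f K) \ Bad' K t, ∀ s : ℝ, |s| ≤ l₀ →
      0 < ∑ τ ∈ (T K).filter (fun τ => f K τ = k), A K s τ ∧ 0 < ∑ τ ∈ (T K).filter (fun τ => f K τ = k), Bf K s τ)
    (hω : ∀ (K : ℕ) (t : ℝ), |t| ≤ l₀ → ∀ k ∈ (T K).image (f K) \ Bad' K t,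
      ∀ τ ∈ (T K).filter (fun τ => f K τ = k), ∀ τ' ∈ (T K).filter (fun τ => f K τ = k), ∀ s : ℝ, |s| ≤ l₀ →
        |tiltedMean (F K) (ν K τ) s - tiltedMean (F K) (ν K τ') s| ≤ ω K) (hω0 : ∀ K, 0 ≤ ω K) (hωs : Summable ω)
    (hW : ∀ (K : ℕ) (t : ℝ), |t| ≤ l₀ →
      ∑ k ∈ Bad' K t, ∑ τ ∈ (T K).filter (fun τ => f K τ = k), A K t τ ≤ W K * ∑ k ∈ (T K).image (f K), ∑ τ ∈ (T K).filter (fun τ => f K τ = k), A K t τ)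
    (hWs : Summable W) (hρ0 : ∀ K, 0 ≤ ρ K) (hρ1 : ∀ K, ρ K < 1) (hρs : Summable ρ)
    (hρ : ∀ (K : ℕ) (t : ℝ), |t| ≤ l₀ → ∀ S' ⊆ (T K).image (f K),
      |(∑ k ∈ S', ∑ τ ∈ (T K).filter (fun τ => f K τ = k), A K t τ) / (∑ k ∈ (T K).image (f K), ∑ τ ∈ (T K).filter (fun τ => f K τ = k), A K t τ)
        - (∑ k ∈ S', ∑ τ ∈ (T K).filter (fun τ => f K τ = k), Bf K t τ) / (∑ k ∈ (T K).image (f K), ∑ τ ∈ (T K).filter (fun τ => f K τ = k), Bf K t τ)| ≤ ρ K)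
    (hZA : ∀ (K : ℕ) (t : ℝ), |t| ≤ l₀ → 0 < ∑ τ ∈ T K, A K t τ) (hZB : ∀ (K : ℕ) (t : ℝ), |t| ≤ l₀ → 0 < ∑ τ ∈ T K, Bf K t τ)
    (hZA' : ∀ (K : ℕ) (t : ℝ), |t| ≤ l₀ → Z K t = ∑ τ ∈ T K, A K t τ)
    (hZB' : ∀ (K : ℕ) (t : ℝ), |t| ≤ l₀ → Z (K + 1) t = ∑ τ ∈ T K, Bf K t τ) :
    ∃ shA shB : ℕ → ℝ → κ → ℝ,
      HybridNE7 l₀ vol (fun K => (T K).image (f K))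
        (fun K t k => ∑ τ ∈ (T K).filter (fun τ => f K τ = k), A K t τ)
        (fun K t k => ∑ τ ∈ (T K).filter (fun τ => f K τ = k), Bf K t τ)
        (fun _ _ => ∅) (fun _ => 0) shA shB ρ (fun K => l₀ * ((η K + ω K) + 2 * B * W K + 2 * B * ρ K) / vol) :=
  exists_hybridNE7_of_binder_classLawTV (Z := Z) (mgfForm_push hA f) (mgfForm_push hB f) (tiltedMeanMatching_push_of_fibreOsc hA hB hη hgood hpos hω)
    (fun K => add_nonneg (hη0 K) (hω0 K)) hBadT' hW hρ
    (fun K t ht => by rw [sum_push_image_eq_sum]; exact hZA K t ht) (fun K t ht => by rw [sum_push_image_eq_sum]; exact hZB K t ht)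
    hl₀ hvol (hηs.add hωs) hWs hρ0 hρ1 hρs
    (fun K t ht => by rw [sum_push_image_eq_sum]; exact hZA' K t ht) (fun K t ht => by rw [sum_push_image_eq_sum]; exact hZB' K t ht)

end Push

end YMDAG.N14.BinderKeyCoarsening

end
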